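import Mathlib
import Summits.Ventures.PercRepro2.Defs
import Summits.Ventures.PercRepro2.CoinTraceBlock
import Summits.Ventures.PercRepro2.CoinTraceShift
import Summits.Ventures.PercRepro2.CoinTraceBlocks
import Summits.Ventures.PercRepro2.CoinTraceBlocks2

/-!
# The HARD up-set of the pathstar is a sign-method block (blind cell PercRepro2, night-2 g4;
proofs/NIGHT2-DARC.md §23.1)

`P = {w, v₁, v₂, v₃}` with the pathstar structure `w → v₁ → v₂ → t, w → v₃ → t`; traces with mass
`N = {∅, v₂, v₃, v₁v₂, v₂v₃, v₁v₂v₃}` and the pivotal family `{A = wv₁v₂, B = wv₃, C = wv₂v₃, P}`.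
The family `H = 𝒩_w ∪ {C, P}` (the up-set `{wv₂v₃, P}` of NIGHT2-DARC.md §15.9, which g2 could only
certify by LP and g3 avoided by the subadditivity hypothesis of `pathStar_functional_nonneg`) has a
nonnegative block (`pathStar_hard_block_nonneg`) by a THREE-CASE argument on the pivotal data at
`B = wv₃`: if `T̂_B ≤ 0`, `G(H) = G(𝒩_w ∪ 𝒱_{v₃}) − μ_B T̂_B`; if `B` lies below both means, so do
`C ⊇ B` and `P ⊇ B` and `G(H) ≥ G(𝒩_w)`; if `B` lies above both means, so does the non-pivotal
trace `{v₃} ⊆ B`, and `H = 𝒩_{wv₃} ⊔ {v₃} ⊔ 𝒱_{v₂v₃}` is an avoidance block plus a pointwise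
positive trace plus the PAIR-cylinder block `{Z ⊇ {v₂, v₃}}` with the pivotal data (PA by
pinning `e₃, e₅`, shifts `≤ 0`).  With `H` as a seventh good family the pivotal weight has an
explicit nonnegative decomposition for EVERY monotone `ρ` (CoinPathStarAbstract2.lean), so the
subadditivity `ρ_C ≤ ρ_A + ρ_B` of §19 is no longer needed.
-/

namespace Summit.Ventures.PercRepro2.Coin

section PathStarHard

open Classical

variable {V : Type*} [DecidableEq V] {R : Type*} [Field R] [LinearOrder R] [IsStrictOrderedRing R]

set_option maxHeartbeats 400000 in
/-- **The hard block of the pathstar** `H = 𝒩_w ∪ {Z : v₂ ∈ Z ∧ v₃ ∈ Z}` is nonnegative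
(NIGHT2-DARC.md §23.1): a three-case argument on the pivotal data at `B = {w, v₃}`. -/
theorem pathStar_hard_block_nonneg {w v₁ v₂ v₃ : V} (hwv₁ : w ≠ v₁) (hwv₂ : w ≠ v₂)
    (hwv₃ : w ≠ v₃) (hv₁₂ : v₁ ≠ v₂) (hv₁₃ : v₁ ≠ v₃) (hv₂₃ : v₂ ≠ v₃)
    (μ x y xh yh : Finset V → R)
    (hμ : ∀ Z ∈ ({w, v₁, v₂, v₃} : Finset V).powerset, 0 ≤ μ Z)
    (hμ0a : ∀ Z ∈ ({w, v₁, v₂, v₃} : Finset V).powerset, v₁ ∈ Z → v₂ ∉ Z → μ Z = 0)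
    (hx1 : ∀ Z : Finset V, Z ⊆ ({w, v₁, v₂, v₃} : Finset V) → x Z ≤ 1)
    (hy1 : ∀ Z : Finset V, Z ⊆ ({w, v₁, v₂, v₃} : Finset V) → y Z ≤ 1)
    (hxh1 : ∀ Z : Finset V, Z ⊆ ({w, v₁, v₂, v₃} : Finset V) → xh Z ≤ 1)
    (hyh1 : ∀ Z : Finset V, Z ⊆ ({w, v₁, v₂, v₃} : Finset V) → yh Z ≤ 1)
    (hxanti : ∀ Z Z' : Finset V, Z ⊆ Z' → Z' ⊆ ({w, v₁, v₂, v₃} : Finset V) → x Z' ≤ x Z)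
    (hyanti : ∀ Z Z' : Finset V, Z ⊆ Z' → Z' ⊆ ({w, v₁, v₂, v₃} : Finset V) → y Z' ≤ y Z)
    (hxhanti : ∀ Z Z' : Finset V, Z ⊆ Z' → Z' ⊆ ({w, v₁, v₂, v₃} : Finset V) → xh Z' ≤ xh Z)
    (hyhanti : ∀ Z Z' : Finset V, Z ⊆ Z' → Z' ⊆ ({w, v₁, v₂, v₃} : Finset V) → yh Z' ≤ yh Z)
    (hxh_le : ∀ Z : Finset V, Z ⊆ ({w, v₁, v₂, v₃} : Finset V) → xh Z ≤ x Z)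
    (hyh_le : ∀ Z : Finset V, Z ⊆ ({w, v₁, v₂, v₃} : Finset V) → yh Z ≤ y Z)
    (hxh_eq : ∀ Z : Finset V, Z ⊆ ({w, v₁, v₂, v₃} : Finset V) → w ∉ Z → xh Z = x Z)
    (hyh_eq : ∀ Z : Finset V, Z ⊆ ({w, v₁, v₂, v₃} : Finset V) → w ∉ Z → yh Z = y Z)
    (hPA : TracePA ({w, v₁, v₂, v₃} : Finset V) μ)
    (hCU₃ : TraceCUPA ({w, v₁, v₂, v₃} : Finset V) μ v₃)
    (hCU₂₃ : ∀ f₁ f₂ : Finset V → R,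
      (∀ Z Z' : Finset V, Z ⊆ Z' → Z' ⊆ ({w, v₁, v₂, v₃} : Finset V) → f₁ Z ≤ f₁ Z') →
      (∀ Z Z' : Finset V, Z ⊆ Z' → Z' ⊆ ({w, v₁, v₂, v₃} : Finset V) → f₂ Z ≤ f₂ Z') →
      (∀ Z : Finset V, Z ⊆ ({w, v₁, v₂, v₃} : Finset V) → 0 ≤ f₁ Z) →
      (∀ Z : Finset V, Z ⊆ ({w, v₁, v₂, v₃} : Finset V) → 0 ≤ f₂ Z) →
      (∑ Z ∈ ({w, v₁, v₂, v₃} : Finset V).powerset.filter (fun Z => v₂ ∈ Z ∧ v₃ ∈ Z), f₁ Z * μ Z) *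
          (∑ Z ∈ ({w, v₁, v₂, v₃} : Finset V).powerset.filter (fun Z => v₂ ∈ Z ∧ v₃ ∈ Z), f₂ Z * μ Z) ≤
        (∑ Z ∈ ({w, v₁, v₂, v₃} : Finset V).powerset.filter (fun Z => v₂ ∈ Z ∧ v₃ ∈ Z), f₁ Z * f₂ Z * μ Z) *
          ∑ Z ∈ ({w, v₁, v₂, v₃} : Finset V).powerset.filter (fun Z => v₂ ∈ Z ∧ v₃ ∈ Z), μ Z) :
    0 ≤ ∑ Z ∈ ({w, v₁, v₂, v₃} : Finset V).powerset.filter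
        (fun Z => Disjoint Z {w} ∨ (v₂ ∈ Z ∧ v₃ ∈ Z)),
      μ Z * (xh Z * (∑ Z' ∈ ({w, v₁, v₂, v₃} : Finset V).powerset, μ Z')
          - ∑ Z' ∈ ({w, v₁, v₂, v₃} : Finset V).powerset, x Z' * μ Z') *
        (yh Z * (∑ Z' ∈ ({w, v₁, v₂, v₃} : Finset V).powerset, μ Z')
          - ∑ Z' ∈ ({w, v₁, v₂, v₃} : Finset V).powerset, y Z' * μ Z') := by
  set P : Finset V := {w, v₁, v₂, v₃} with hPdef
  have hwP : w ∈ P := by simp [hPdef]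
  have hv₃P : v₃ ∈ P := by simp [hPdef]
  have hBP : ({w, v₃} : Finset V) ⊆ P := by
    intro z hz
    simp only [Finset.mem_insert, Finset.mem_singleton] at hz
    rcases hz with rfl | rfl <;> simp [hPdef]
  obtain ⟨Λ, hΛ⟩ : ∃ L : R, L = ∑ Z ∈ P.powerset, μ Z := ⟨_, rfl⟩
  obtain ⟨MX, hMX⟩ : ∃ M : R, M = ∑ Z ∈ P.powerset, x Z * μ Z := ⟨_, rfl⟩
  obtain ⟨MY, hMY⟩ : ∃ M : R, M = ∑ Z ∈ P.powerset, y Z * μ Z := ⟨_, rfl⟩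
  have hΛn : 0 ≤ Λ := by rw [hΛ]; exact Finset.sum_nonneg hμ
  rw [← hΛ, ← hMX, ← hMY]
  -- the term of a trace
  set T : Finset V → R := fun Z => μ Z * (xh Z * Λ - MX) * (yh Z * Λ - MY) with hTdef
  show 0 ≤ ∑ Z ∈ P.powerset.filter (fun Z => Disjoint Z {w} ∨ (v₂ ∈ Z ∧ v₃ ∈ Z)), T Z
  -- the three blocks available in every case
  have hV₃ : 0 ≤ ∑ Z ∈ P.powerset.filter (fun Z => Disjoint Z {w} ∨ v₃ ∈ Z), T Z := by
    have h := cylinder_block_nonneg P hwP hv₃P μ x y xh yh hμ hx1 hy1 hxh1 hyh1 hxanti hyanti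
      hxhanti hyhanti hxh_le hyh_le hxh_eq hyh_eq hPA hCU₃
    rw [← hΛ, ← hMX, ← hMY] at h
    exact h
  have hTop : 0 ≤ ∑ Z ∈ P.powerset.filter (fun Z => Disjoint Z {w} ∨ Z = P), T Z := by
    have h := top_block_nonneg P hwP μ x y xh yh hμ hx1 hy1 hxh1 hyh1 hxanti hyanti hxhanti
      hyhanti hxh_le hyh_le hxh_eq hyh_eq hPA
    rw [← hΛ, ← hMX, ← hMY] at h
    exact h
  have hAv : 0 ≤ ∑ Z ∈ P.powerset.filter (fun Z => Disjoint Z {w, v₃}), T Z := by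
    have h := avoidU_block_nonneg P {w, v₃} (by simp) hBP μ x y xh yh hμ hx1 hy1 hxh1 hyh1
      hxanti hyanti hxhanti hyhanti hxh_eq hyh_eq hPA
    rw [← hΛ, ← hMX, ← hMY] at h
    exact h
  have hCyl : 0 ≤ ∑ Z ∈ P.powerset.filter (fun Z => v₂ ∈ Z ∧ v₃ ∈ Z), T Z := by
    have h := cylinder₂_block_nonneg P μ x y xh yh hμ hx1 hy1 hxh1 hyh1 hxanti hyanti hxhanti
      hyhanti hxh_le hyh_le hPA hCU₂₃
    rw [← hΛ, ← hMX, ← hMY] at h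
    exact h
  -- the pivotal data at `B = {w, v₃}`
  set B : Finset V := {w, v₃} with hBdef
  have hBpow : B ∈ P.powerset := Finset.mem_powerset.mpr hBP
  have hμB : 0 ≤ μ B := hμ B hBpow
  by_cases hTB : (xh B * Λ - MX) * (yh B * Λ - MY) ≤ 0
  · -- CASE 1: `T̂_B ≤ 0`: `G(H) = G(𝒩_w ∪ 𝒱_{v₃}) − (terms at traces with w, v₃ ∈ Z, v₂ ∉ Z)`
    have hsplit := Finset.sum_filter_add_sum_filter_not
      (P.powerset.filter (fun Z => Disjoint Z {w} ∨ v₃ ∈ Z)) (fun Z => v₂ ∈ Z ∨ Disjoint Z {w}) T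
    have e1 : (P.powerset.filter (fun Z => Disjoint Z {w} ∨ v₃ ∈ Z)).filter
        (fun Z => v₂ ∈ Z ∨ Disjoint Z {w}) =
        P.powerset.filter (fun Z => Disjoint Z {w} ∨ (v₂ ∈ Z ∧ v₃ ∈ Z)) := by
      rw [Finset.filter_filter]
      refine Finset.filter_congr fun Z _ => ?_
      constructor
      · rintro ⟨h1 | h1, h2 | h2⟩
        · exact Or.inl h1
        · exact Or.inl h2
        · exact Or.inr ⟨h2, h1⟩
        · exact Or.inl h2
      · rintro (h | ⟨h2, h3⟩)
        · exact ⟨Or.inl h, Or.inr h⟩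
        · exact ⟨Or.inr h3, Or.inl h2⟩
    rw [e1] at hsplit
    -- the removed terms are `≤ 0`
    have hrest : ∑ Z ∈ (P.powerset.filter (fun Z => Disjoint Z {w} ∨ v₃ ∈ Z)).filter
        (fun Z => ¬ (v₂ ∈ Z ∨ Disjoint Z {w})), T Z ≤ 0 := by
      refine Finset.sum_nonpos fun Z hZ => ?_
      rw [Finset.mem_filter, Finset.mem_filter] at hZ
      obtain ⟨⟨hZpow, hZ1⟩, hZ2⟩ := hZ
      have hv₂Z : v₂ ∉ Z := fun h => hZ2 (Or.inl h)
      have hwZ : w ∈ Z := by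
        by_contra hw
        exact hZ2 (Or.inr (Finset.disjoint_singleton_right.mpr hw))
      have hv₃Z : v₃ ∈ Z := by
        rcases hZ1 with h | h
        · exact absurd (Finset.disjoint_singleton_right.mp h) (fun h' => h' hwZ)
        · exact h
      by_cases hv₁Z : v₁ ∈ Z
      · show μ Z * (xh Z * Λ - MX) * (yh Z * Λ - MY) ≤ 0
        rw [hμ0a Z hZpow hv₁Z hv₂Z]
        simp
      · -- `Z = B`
        have hZB : Z = B := by
          apply Finset.Subset.antisymm
          · intro z hz
            have := Finset.mem_powerset.mp hZpow hz
            simp only [hPdef, Finset.mem_insert, Finset.mem_singleton] at this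
            rcases this with rfl | rfl | rfl | rfl
            · simp [hBdef]
            · exact absurd hz hv₁Z
            · exact absurd hz hv₂Z
            · simp [hBdef]
          · intro z hz
            simp only [hBdef, Finset.mem_insert, Finset.mem_singleton] at hz
            rcases hz with rfl | rfl
            · exact hwZ
            · exact hv₃Z
        show μ Z * (xh Z * Λ - MX) * (yh Z * Λ - MY) ≤ 0
        rw [hZB, mul_assoc]
        exact mul_nonpos_of_nonneg_of_nonpos hμB hTB
    linarith [hsplit, hV₃, hrest]
  · have hTBpos : 0 < (xh B * Λ - MX) * (yh B * Λ - MY) := lt_of_not_ge hTB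
    rcases pos_and_pos_or_neg_and_neg_of_mul_pos hTBpos with ⟨hxB, hyB⟩ | ⟨hxB, hyB⟩
    · -- CASE 3: `B` above both means: `H = 𝒩_{wv₃} ⊔ {Z ∌ w, v₃ ∈ Z, v₂ ∉ Z} ⊔ 𝒱_{v₂v₃}`
      have hsplit := Finset.sum_filter_add_sum_filter_not
        (P.powerset.filter (fun Z => Disjoint Z {w} ∨ (v₂ ∈ Z ∧ v₃ ∈ Z)))
        (fun Z => Disjoint Z {w, v₃}) T
      have e1 : (P.powerset.filter (fun Z => Disjoint Z {w} ∨ (v₂ ∈ Z ∧ v₃ ∈ Z))).filter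
          (fun Z => Disjoint Z {w, v₃}) = P.powerset.filter (fun Z => Disjoint Z {w, v₃}) := by
        rw [Finset.filter_filter]
        refine Finset.filter_congr fun Z _ => ?_
        constructor
        · exact fun h => h.2
        · intro h
          exact ⟨Or.inl (Finset.disjoint_of_subset_right (by simp) h), h⟩
      have hsplit2 := Finset.sum_filter_add_sum_filter_not
        ((P.powerset.filter (fun Z => Disjoint Z {w} ∨ (v₂ ∈ Z ∧ v₃ ∈ Z))).filter
          (fun Z => ¬ Disjoint Z {w, v₃})) (fun Z => v₂ ∈ Z ∧ v₃ ∈ Z) T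
      have e2 : ((P.powerset.filter (fun Z => Disjoint Z {w} ∨ (v₂ ∈ Z ∧ v₃ ∈ Z))).filter
          (fun Z => ¬ Disjoint Z {w, v₃})).filter (fun Z => v₂ ∈ Z ∧ v₃ ∈ Z) =
          P.powerset.filter (fun Z => v₂ ∈ Z ∧ v₃ ∈ Z) := by
        rw [Finset.filter_filter, Finset.filter_filter]
        refine Finset.filter_congr fun Z _ => ?_
        constructor
        · exact fun h => h.2.2
        · intro h
          refine ⟨Or.inr h, ?_, h⟩
          intro hd
          exact (Finset.disjoint_left.mp hd h.2) (by simp)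
      rw [e2] at hsplit2
      rw [e1] at hsplit
      -- the middle family is pointwise nonnegative
      have hmid : 0 ≤ ∑ Z ∈ ((P.powerset.filter (fun Z => Disjoint Z {w} ∨ (v₂ ∈ Z ∧ v₃ ∈ Z))).filter
          (fun Z => ¬ Disjoint Z {w, v₃})).filter (fun Z => ¬ (v₂ ∈ Z ∧ v₃ ∈ Z)), T Z := by
        refine Finset.sum_nonneg fun Z hZ => ?_
        rw [Finset.mem_filter, Finset.mem_filter, Finset.mem_filter] at hZ
        obtain ⟨⟨⟨hZpow, hZ1⟩, hZ2⟩, hZ3⟩ := hZ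
        have hwZ : w ∉ Z := by
          rcases hZ1 with h | h
          · exact Finset.disjoint_singleton_right.mp h
          · exact absurd h hZ3
        have hv₃Z : v₃ ∈ Z := by
          by_contra h
          exact hZ2 (Finset.disjoint_insert_right.mpr
            ⟨hwZ, Finset.disjoint_singleton_right.mpr h⟩)
        have hv₂Z : v₂ ∉ Z := fun h => hZ3 ⟨h, hv₃Z⟩
        have hZP : Z ⊆ P := Finset.mem_powerset.mp hZpow
        by_cases hv₁Z : v₁ ∈ Z
        · show 0 ≤ μ Z * (xh Z * Λ - MX) * (yh Z * Λ - MY)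
          rw [hμ0a Z hZpow hv₁Z hv₂Z]
          simp
        · have hZB : Z ⊆ B := by
            intro z hz
            have := hZP hz
            simp only [hPdef, Finset.mem_insert, Finset.mem_singleton] at this
            rcases this with rfl | rfl | rfl | rfl
            · exact absurd hz hwZ
            · exact absurd hz hv₁Z
            · exact absurd hz hv₂Z
            · simp [hBdef]
          have hxZ : xh B * Λ - MX ≤ xh Z * Λ - MX := by
            rw [hxh_eq Z hZP hwZ]
            have h1 : x B ≤ x Z := hxanti Z B hZB hBP
            have h2 : xh B ≤ x B := hxh_le B hBP
            nlinarith [mul_le_mul_of_nonneg_right (h2.trans h1) hΛn]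
          have hyZ : yh B * Λ - MY ≤ yh Z * Λ - MY := by
            rw [hyh_eq Z hZP hwZ]
            have h1 : y B ≤ y Z := hyanti Z B hZB hBP
            have h2 : yh B ≤ y B := hyh_le B hBP
            nlinarith [mul_le_mul_of_nonneg_right (h2.trans h1) hΛn]
          show 0 ≤ μ Z * (xh Z * Λ - MX) * (yh Z * Λ - MY)
          rw [mul_assoc]
          exact mul_nonneg (hμ Z hZpow) (mul_nonneg (by linarith) (by linarith))
      linarith [hsplit, hsplit2, hAv, hCyl, hmid]
    · -- CASE 2: `B` below both means: the pivotal traces `⊇ B` have nonnegative terms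
      have hsplit := Finset.sum_filter_add_sum_filter_not
        (P.powerset.filter (fun Z => Disjoint Z {w} ∨ (v₂ ∈ Z ∧ v₃ ∈ Z)))
        (fun Z => Disjoint Z {w} ∨ Z = P) T
      have e1 : (P.powerset.filter (fun Z => Disjoint Z {w} ∨ (v₂ ∈ Z ∧ v₃ ∈ Z))).filter
          (fun Z => Disjoint Z {w} ∨ Z = P) = P.powerset.filter (fun Z => Disjoint Z {w} ∨ Z = P) := by
        rw [Finset.filter_filter]
        refine Finset.filter_congr fun Z _ => ?_
        constructor
        · exact fun h => h.2
        · rintro (h | h)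
          · exact ⟨Or.inl h, Or.inl h⟩
          · refine ⟨Or.inr ⟨?_, ?_⟩, Or.inr h⟩
            · rw [h]; simp [hPdef]
            · rw [h]; simp [hPdef]
      rw [e1] at hsplit
      have hrest : 0 ≤ ∑ Z ∈ (P.powerset.filter (fun Z => Disjoint Z {w} ∨ (v₂ ∈ Z ∧ v₃ ∈ Z))).filter
          (fun Z => ¬ (Disjoint Z {w} ∨ Z = P)), T Z := by
        refine Finset.sum_nonneg fun Z hZ => ?_
        rw [Finset.mem_filter, Finset.mem_filter] at hZ
        obtain ⟨⟨hZpow, hZ1⟩, hZ2⟩ := hZ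
        have hwZ : w ∈ Z := by
          by_contra hw
          exact hZ2 (Or.inl (Finset.disjoint_singleton_right.mpr hw))
        have hv₃Z : v₃ ∈ Z := by
          rcases hZ1 with h | h
          · exact absurd (Finset.disjoint_singleton_right.mp h) (fun h' => h' hwZ)
          · exact h.2
        have hBZ : B ⊆ Z := by
          intro z hz
          simp only [hBdef, Finset.mem_insert, Finset.mem_singleton] at hz
          rcases hz with rfl | rfl
          · exact hwZ
          · exact hv₃Z
        have hZP : Z ⊆ P := Finset.mem_powerset.mp hZpow
        have hxZ : xh Z * Λ - MX ≤ xh B * Λ - MX := by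
          have h1 : xh Z ≤ xh B := hxhanti B Z hBZ hZP
          nlinarith [mul_le_mul_of_nonneg_right h1 hΛn]
        have hyZ : yh Z * Λ - MY ≤ yh B * Λ - MY := by
          have h1 : yh Z ≤ yh B := hyhanti B Z hBZ hZP
          nlinarith [mul_le_mul_of_nonneg_right h1 hΛn]
        show 0 ≤ μ Z * (xh Z * Λ - MX) * (yh Z * Λ - MY)
        rw [mul_assoc]
        exact mul_nonneg (hμ Z hZpow) (mul_nonneg_of_nonpos_of_nonpos (by linarith) (by linarith))
      linarith [hsplit, hTop, hrest]

end PathStarHard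

end Summit.Ventures.PercRepro2.Coin
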